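import Summits.ResolutionOfSingularities.ResolutionOfSingularities.Theorems.DeltaCutStellarStrategyAbstract

/-!
# StellarCut T16 — «StrategyStar»: the terminating face strategy for shapes that are stable ONLY ALONG THE STRATEGY
# (lens-6 «barrier-complement carving», g34; 0-weight tool of the wild coprime law `DeltaCutStellarWild`)

`DeltaCutStellarStrategyAbstract.FaceStableShape n P` (T9) asks the shape `P` to survive the blow-up of EVERY face through `H` of
weight `≥ n`.  The wild coprime shape of `DeltaCutStellarWild` (marking `n = p` the residue characteristic, boundary labels `0` or
prime to `p`) does NOT: the face of `{H, D₁, D₂}` with labels `(1, 2p − 1)` has weight `2p` and its blow-up creates the label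
`p`.  It survives exactly the rounds THE STRATEGY PERFORMS — in Kollár's phase `r` (all `s`-faces through `H`, `s < r`, of weight
`< n`: `StarBelowH E H n r`, T5) the new label `weightOf E T − n` of an `r`-face `T ∋ H` is `< p` (`r ≥ 3`) or congruent to the
old one (`r = 2`).

THIS FILE weakens the `round` field accordingly — `FaceStableShapeStar n P`: the round lemma additionally RECEIVES the phase data
`T ∈ incSubsetsH E H r`, `StarBelowH E H n r` and `H ∈ boundaryOf E`, all of which are in scope at the single call site of
`round` in T9's induction — and re-runs T9's induction VERBATIM (`FaceStableShapeStar.exists_weakResolution_of_starBelowH`,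
`FaceStableShapeStar.exists_weakResolution`); every `FaceStableShape` is a `FaceStableShapeStar` (`FaceStableShape.toStar`), so T9
is recovered (closing `example`).  0 sorry; axioms standard. [new] [folklore] [cite: Kollar2007, (3.111) Step 3]
[cite: BierstoneGrigorievMilmanWlodarczyk2011, Def. 3.1.3]
-/

noncomputable section

open CategoryTheory CategoryTheory.Limits AlgebraicGeometry TopologicalSpace IsLocalRing
open Literature.AlgebraicGeometry.Resolution

namespace Summit.ResolutionOfSingularities.ResolutionOfSingularities.Theorems.DeltaCutClasses

section StrategyStar

open Summit.ResolutionOfSingularities.ResolutionOfSingularities.Theorems.WeakOrderReduction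

/-- **`FaceStableShapeStar n P` — face stability ALONG THE STRATEGY**: as `FaceStableShape n P` (T9), except that `round` is only
required for the faces the strategy blows up — an `r`-face `T ∋ H` of weight `≥ n` IN PHASE `r` (`T ∈ incSubsetsH E H r`,
`StarBelowH E H n r`), with `H ∈ boundaryOf E`. -/
structure FaceStableShapeStar (n : ℕ) (P : Shape) : Prop where
  /-- the shape survives a STRATEGY round: the face of an `r`-set `T ∋ H` of weight `≥ n` in phase `r` -/
  round : ∀ (X : Scheme.{0}) [IsLocallyNoetherian X] (E : List (X.IdealSheafData × ℕ)) (H : X.IdealSheafData)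
    (T : Finset X.IdealSheafData) (M : MarkedIdeal X) (r : ℕ), HasSNC (H :: boundaryOf E) → H ∈ boundaryOf E →
    (∀ K ∈ T, K ∈ H :: boundaryOf E) → H ∈ T → n ≤ weightOf E T → T ∈ incSubsetsH E H r → StarBelowH E H n r → P X E H M →
      P (blowup (T.sup id)) (transformExp E (blowup.π (T.sup id)) T n)
        (strictTransformIdeal (blowup.π (T.sup id)) (T.sup id) H) (M.transform (blowup.π (T.sup id)) (T.sup id))
  /-- a face through `H` of weight `≥ n` lies in the support -/
  face : ∀ (X : Scheme.{0}) [IsLocallyNoetherian X] (E : List (X.IdealSheafData × ℕ)) (H : X.IdealSheafData)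
    (T : Finset X.IdealSheafData) (M : MarkedIdeal X), HasSNC (H :: boundaryOf E) → H ∈ T → n ≤ weightOf E T →
    P X E H M → ((T.sup id).support : Set X) ⊆ M.support
  /-- if every point of `V(H)` has boundary weight `< n`, the support is empty -/
  terminal : ∀ (X : Scheme.{0}) [IsLocallyNoetherian X] (E : List (X.IdealSheafData × ℕ)) (H : X.IdealSheafData)
    (M : MarkedIdeal X), HasSNC (H :: boundaryOf E) → H ∈ boundaryOf E → P X E H M →
    (∀ x ∈ H.support, weightAt E x < n) → M.support = ∅

/-- every face-stable shape is face-stable along the strategy. [folklore] -/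
theorem FaceStableShape.toStar {n : ℕ} {P : Shape} (S : FaceStableShape n P) : FaceStableShapeStar n P where
  round X _ E H T M _ hEs _ hT hHT hmT _ _ hP := S.round X E H T M hEs hT hHT hmT hP
  face := S.face
  terminal := S.terminal

namespace FaceStableShapeStar

variable {n : ℕ} {P : Shape}

/-- **ONE ROUND, resolution**: if the rest weakly resolves the transform of a `P`-datum under the blow-up of a face through `H`
of weight `≥ n`, the whole sequence weakly resolves it (only `face` is used). -/
theorem weakResolution_cons (S : FaceStableShapeStar n P) {X : Scheme.{0}} [IsLocallyNoetherian X]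
    {E : List (X.IdealSheafData × ℕ)} {H : X.IdealSheafData} {T : Finset X.IdealSheafData}
    (hEs : HasSNC (H :: boundaryOf E)) (hT : ∀ K ∈ T, K ∈ H :: boundaryOf E) (hHT : H ∈ T) (hn : n ≤ weightOf E T)
    (M : MarkedIdeal X) (hP : P X E H M) {rest : CentreSeq (blowup (T.sup id))}
    (hrest : WeakResolution rest (M.transform (blowup.π (T.sup id)) (T.sup id))) :
    WeakResolution (.cons (T.sup id) rest) M :=
  ⟨⟨S.face X E H T M hEs hHT hn hP, hEs.isRegular_subscheme_finsetSup T hT, hrest.1⟩, hrest.2⟩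

/-- **"At the end of phase `N` we are done"** (only `terminal` is used). -/
theorem support_eq_empty_of_starBelowH (S : FaceStableShapeStar n P) {X : Scheme.{0}} [IsLocallyNoetherian X]
    {E : List (X.IdealSheafData × ℕ)} {H : X.IdealSheafData} (hEs : HasSNC (H :: boundaryOf E))
    (hH : H ∈ boundaryOf E) {N : ℕ} (hN : ∀ x, (divThrough E x).card ≤ N) (h : StarBelowH E H n (N + 1))
    (M : MarkedIdeal X) (hP : P X E H M) : M.support = ∅ := by
  refine S.terminal X E H M hEs hH hP fun x hx => ?_
  rw [weightAt_eq_weightOf_divThrough]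
  exact h (divThrough E x).card (Nat.lt_succ_of_le (hN x)) _ (divThrough_mem_incSubsets E x)
    (mem_divThrough_iff.mpr ⟨hH, hx⟩)

/-- **THE FACE STRATEGY, PHASE BY PHASE, FOR A SHAPE STABLE ALONG THE STRATEGY** — T9's
`FaceStableShape.exists_weakResolution_of_starBelowH` VERBATIM, the round lemma now being fed the phase data
`T ∈ incSubsetsH E H r`, `StarBelowH E H n r`, `H ∈ boundaryOf E` available at its call site. [cite: Kollar2007, (3.111) Step 3] -/
theorem exists_weakResolution_of_starBelowH (S : FaceStableShapeStar n P) (N : ℕ) :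
    ∀ (d r : ℕ), r + d = N + 1 → ∀ (W c : ℕ) (X : Scheme.{0}) [IsLocallyNoetherian X]
      (E : List (X.IdealSheafData × ℕ)) (H : X.IdealSheafData), HasSNC (H :: boundaryOf E) →
      H ∈ boundaryOf E → (∀ x, (divThrough E x).card ≤ N) → StarBelowH E H n r →
      maxWeightH E H r = W → numMaxH E H r = c → ∀ M : MarkedIdeal X,
      P X E H M → ∃ s : CentreSeq X, WeakResolution s M := by
  classical
  intro d
  induction d with
  | zero =>
    intro r hr W c X _ E H hEs hH hN hstar _ _ M hP
    refine ⟨CentreSeq.nil X, weakResolution_nil_of_support_eq_empty M ?_⟩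
    rw [Nat.add_zero] at hr
    exact S.support_eq_empty_of_starBelowH hEs hH hN (hr ▸ hstar) M hP
  | succ d ihd =>
    -- lexicographic induction on `(W, c) = (m_r^H, n_r^H)`
    intro r hr W
    induction W using Nat.strong_induction_on with
    | _ W ihW =>
    intro c
    induction c using Nat.strong_induction_on with
    | _ c ihc =>
    intro X _ E H hEs hH hN hstar hW hc M hP
    by_cases hnext : ∀ T ∈ incSubsetsH E H r, weightOf E T < n
    · -- no `r`-set through `H` reaches `n`: `(*_r)^H` holds, pass to phase `r + 1`
      exact ihd (r + 1) (by omega) _ _ X E H hEs hH hN (hstar.succ hnext) rfl rfl M hP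
    · -- blow up the face of an `r`-set through `H` of maximal weight
      push Not at hnext
      obtain ⟨T₀, hT₀, hmT₀⟩ := hnext
      obtain ⟨T, hTrH, hTmax⟩ := Finset.exists_mem_eq_sup (incSubsetsH E H r) ⟨T₀, hT₀⟩ (weightOf E)
      have hTmax' : weightOf E T = maxWeightH E H r := hTmax.symm
      have hmT : n ≤ weightOf E T := hmT₀.trans (hTmax ▸ weightOf_le_maxWeightH hT₀)
      obtain ⟨hTr, hHT⟩ := mem_incSubsetsH_iff.mp hTrH
      have hE : HasSNC (boundaryOf E) := hasSNC_boundaryOf_of_cons hEs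
      have hT : ∀ K ∈ T, K ∈ boundaryOf E := fun K hK =>
        mem_sheaves_iff.mp ((mem_incSubsets_iff.mp hTr).1 hK)
      have hT' : ∀ K ∈ T, K ∈ H :: boundaryOf E := fun K hK => List.mem_cons_of_mem _ (hT K hK)
      set C : X.IdealSheafData := T.sup id with hC
      haveI : IsLocallyNoetherian (blowup C) := CentreSeq.isLocallyNoetherian_blowup C
      have hπ : IsBlowup (blowup.π C) (T.sup id) := blowup.isBlowup C
      set E' := transformExp E (blowup.π C) T n with hE'
      set H' := strictTransformIdeal (blowup.π C) (T.sup id) H with hH'def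
      -- the transformed data: the round lemma receives the phase data
      have hP' : P (blowup C) E' H' (M.transform (blowup.π C) C) := S.round X E H T M r hEs hH hT' hHT hmT hTrH hstar hP
      have hEs' : HasSNC (H' :: boundaryOf E') := hasSNC_ncShape_transform hEs hT' hπ n
      have hH' : H' ∈ boundaryOf E' := strictTransform_mem_boundaryOf_transformExp hH n
      have hN' : ∀ x', (divThrough E' x').card ≤ N := fun x' =>
        (card_divThrough_transformExp_le hE hT hπ x').trans (hN _)
      have hstar' : StarBelowH E' H' n r := starBelowH_transformExp hE hH hT hHT hπ hTr hmT hstar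
      have hle : maxWeightH E' H' r ≤ W :=
        hW ▸ maxWeightH_transformExp_le hE hH hT hπ hTr hTmax' hmT hstar
      -- the induction hypothesis applies to the transform
      obtain ⟨s', hs'⟩ : ∃ s' : CentreSeq (blowup C), WeakResolution s' (M.transform (blowup.π C) C) := by
        rcases hle.lt_or_eq with hlt | heq
        · exact ihW _ hlt _ (blowup C) E' H' hEs' hH' hN' hstar' rfl rfl _ hP'
        · have hlt : numMaxH E' H' r < c :=
            hc ▸ numMaxH_transformExp_lt hE hH hT hHT hπ hTr hTmax' hmT hstar (heq.trans hW.symm)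
          exact ihc _ hlt (blowup C) E' H' hEs' hH' hN' hstar' heq rfl _ hP'
      -- prepend the blow-up of the face `C`
      exact ⟨CentreSeq.cons C s', S.weakResolution_cons hEs hT' hHT hmT M hP hs'⟩

/-- ★ **WEAK ORDER REDUCTION FOR ANY SHAPE STABLE ALONG THE STRATEGY**: on a locally Noetherian scheme, a `P`-datum for a
labelled boundary `E` containing `H` with `H :: E` s.n.c. admits a `WeakResolution` (the faces `H ∩ ⋂_{j∈S} K_j` of maximal
weight `≥ n` in Kollár's phases relativised to `H`, until the support is empty). [cite: Kollar2007, (3.111) Step 3] -/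
theorem exists_weakResolution (S : FaceStableShapeStar n P) {X : Scheme.{0}} [IsLocallyNoetherian X]
    {E : List (X.IdealSheafData × ℕ)} {H : X.IdealSheafData} (hEs : HasSNC (H :: boundaryOf E)) (hH : H ∈ boundaryOf E)
    (M : MarkedIdeal X) (hP : P X E H M) : ∃ s : CentreSeq X, WeakResolution s M := by
  classical
  set N := (sheaves E).card with hN
  have hbound : ∀ x, (divThrough E x).card ≤ N := fun x =>
    Finset.card_le_card fun K hK => mem_sheaves_iff.mpr (mem_divThrough_iff.mp hK).1
  exact S.exists_weakResolution_of_starBelowH N (N + 1) 0 (by omega) _ _ X E H hEs hH hbound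
    (fun s hs => absurd hs (Nat.not_lt_zero s)) rfl rfl M hP

end FaceStableShapeStar

-- T9's `FaceStableShape.exists_weakResolution` RE-DERIVED through the star variant (consistency check of the weakening).
example {n : ℕ} {P : Shape} (S : FaceStableShape n P) {X : Scheme.{0}} [IsLocallyNoetherian X]
    {E : List (X.IdealSheafData × ℕ)} {H : X.IdealSheafData} (hEs : HasSNC (H :: boundaryOf E)) (hH : H ∈ boundaryOf E)
    (M : MarkedIdeal X) (hP : P X E H M) : ∃ s : CentreSeq X, WeakResolution s M :=
  S.toStar.exists_weakResolution hEs hH M hP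

end StrategyStar

end Summit.ResolutionOfSingularities.ResolutionOfSingularities.Theorems.DeltaCutClasses
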